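import Literature.Probability.Percolation.OneArmLSW
import Literature.Probability.Percolation.SiteMonotonicity
import HarnessLib

/-!
# A multiscale union bound with independent scales

Topic `Literature/Probability/Percolation`; family `crit-perc`, statement **crit-perc.S16**
(`Literature.Probability.Percolation.triTheta_exponent`). The probabilistic skeleton of the
"first good scale" summation in Kesten's inner-separation argument (H. Kesten, CMP 109 (1987),
proof of Lemma 4; P. Nolin, EJP 13 (2008), §4.5, proof of Prop. 17 [arXiv 0711.4948: Prop. 16]:
decompose according to the first scale at which the good event occurs; the good events of
distinct scales are independent, and the event of scale `j` is independent of the failures at the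
scales `< j`): if `E ⊆ E_j` for every scale `j < J`, the events `G_j` are determined by pairwise
disjoint finite sets `F_j`, and `E_j ∩ G_j` is determined by a finite set `D_j` disjoint from the
`F_i`, `i < j`, then

`P(E) ≤ Σ_{j<J} P(E_j ∩ G_j) · Π_{i<j} P(G_iᶜ) + Π_{i<J} P(G_iᶜ)`.

## References

* H. Kesten, Scaling relations for 2D-percolation, *Comm. Math. Phys.* 109 (1987), proof of
  Lemma 4 [KestenScalingCMP1987].
* P. Nolin, Near-critical percolation in two dimensions, *Electron. J. Probab.* 13 (2008), §4.5,
  proof of Prop. 17 [arXiv 0711.4948: Prop. 16] [Nolin2008].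

## Mathlib / tree

Tree: `sitePercolation_real_iInter_eq_prod` (`OneArmLSW.lean`), `sitePercolation_real_inter_of_disjoint`,
`DeterminedBy.iInter`, `DeterminedBy.compl`, `DeterminedBy.mono`. Mathlib: `measureReal_union_le`,
`measureReal_biUnion_finset_le`, `Nat.find`.
-/

noncomputable section

open Set MeasureTheory

namespace Literature.Probability.Percolation

variable {V : Type*}

/-- **First-good-scale decomposition.** With `F_j := ⋂_{i<j} G_iᶜ` ("no good scale before `j`"):
`E ⊆ (⋃_{j<J} (E_j ∩ G_j) ∩ F_j) ∪ F_J`. [folklore] -/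
theorem subset_iUnion_firstGood {J : ℕ} {E : Set (Set V)} {Es Gs : ℕ → Set (Set V)} (hE : ∀ j < J, E ⊆ Es j) :
    E ⊆ (⋃ j ∈ Finset.range J, ((Es j ∩ Gs j) ∩ ⋂ i < j, (Gs i)ᶜ)) ∪ ⋂ i < J, (Gs i)ᶜ := by
  classical
  intro ω hω
  by_cases h : ∃ j, j < J ∧ ω ∈ Gs j
  · left
    obtain ⟨hj₀J, hj₀G⟩ := Nat.find_spec h
    have hmin : ∀ i < Nat.find h, ω ∉ Gs i := fun i hi hG => Nat.find_min h hi ⟨hi.trans hj₀J, hG⟩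
    simp only [mem_iUnion, Finset.mem_range, mem_inter_iff, mem_iInter, mem_compl_iff]
    exact ⟨Nat.find h, hj₀J, ⟨hE _ hj₀J hω, hj₀G⟩, hmin⟩
  · right
    push Not at h
    simp only [mem_iInter, mem_compl_iff]
    exact fun i hi => h i hi

/-- **Multiscale union bound with independent scales**:
`P(E) ≤ Σ_{j<J} P(E_j ∩ G_j) · Π_{i<j} P(G_iᶜ) + Π_{i<J} P(G_iᶜ)`. [cite: KestenScalingCMP1987, proof of Lemma 4] [cite: Nolin2008, §4.5, proof of Prop. 17 (arXiv 0711.4948: Prop. 16)] -/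
theorem real_le_sum_firstGood (p : unitInterval) {J : ℕ} {E : Set (Set V)} {Es Gs : ℕ → Set (Set V)}
    {D F : ℕ → Finset V} (hE : ∀ j < J, E ⊆ Es j)
    (hdetEG : ∀ j < J, DeterminedBy (Es j ∩ Gs j) ↑(D j)) (hdetG : ∀ j < J, DeterminedBy (Gs j) ↑(F j))
    (hdisjF : ∀ i j, i < j → j < J → Disjoint (F i) (F j))
    (hdisjD : ∀ i j, i < j → j < J → Disjoint (F i) (D j)) :
    (sitePercolation V p).real E ≤
      ∑ j ∈ Finset.range J, (sitePercolation V p).real (Es j ∩ Gs j) *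
          ∏ i ∈ Finset.range j, (sitePercolation V p).real (Gs i)ᶜ +
        ∏ i ∈ Finset.range J, (sitePercolation V p).real (Gs i)ᶜ := by
  classical
  set μ := sitePercolation V p with hμ
  set Fset : ℕ → Set (Set V) := fun j => ⋂ i < j, (Gs i)ᶜ with hFset
  -- the products
  have hprod : ∀ j ≤ J, μ.real (Fset j) = ∏ i ∈ Finset.range j, μ.real (Gs i)ᶜ := by
    intro j hj
    exact sitePercolation_real_iInter_eq_prod p (Y := fun i => (Gs i)ᶜ) (F := F) (N := j)
      (fun i hi => (hdetG i (by omega)).compl) (fun i i' hii' hi' => hdisjF i i' hii' (by omega))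
  -- locality of `Fset j` and independence from scale `j`
  have hdetF : ∀ j ≤ J, DeterminedBy (Fset j) ↑((Finset.range j).biUnion F) := by
    intro j hj
    refine DeterminedBy.iInter fun i => DeterminedBy.iInter fun hi => ?_
    exact ((hdetG i (by omega)).compl).mono
      (Finset.coe_subset.2 (Finset.subset_biUnion_of_mem F (Finset.mem_range.2 hi)))
  have hind : ∀ j < J, μ.real ((Es j ∩ Gs j) ∩ Fset j) = μ.real (Es j ∩ Gs j) * μ.real (Fset j) := by
    intro j hj
    refine sitePercolation_real_inter_of_disjoint p (hdetEG j hj) (hdetF j hj.le) ?_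
    rw [Finset.disjoint_biUnion_right]
    exact fun i hi => (hdisjD i j (Finset.mem_range.1 hi) hj).symm
  -- the union bound
  calc μ.real E ≤ μ.real ((⋃ j ∈ Finset.range J, ((Es j ∩ Gs j) ∩ Fset j)) ∪ Fset J) :=
        measureReal_mono (subset_iUnion_firstGood hE) (measure_ne_top _ _)
    _ ≤ μ.real (⋃ j ∈ Finset.range J, ((Es j ∩ Gs j) ∩ Fset j)) + μ.real (Fset J) := measureReal_union_le _ _
    _ ≤ ∑ j ∈ Finset.range J, μ.real ((Es j ∩ Gs j) ∩ Fset j) + μ.real (Fset J) := by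
        gcongr; exact measureReal_biUnion_finset_le _ _
    _ = _ := by
        rw [hprod J le_rfl]
        congr 1
        exact Finset.sum_congr rfl fun j hj => by
          rw [hind j (Finset.mem_range.1 hj), hprod j (Finset.mem_range.1 hj).le]

end Literature.Probability.Percolation
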